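import Summits.BirchSwinnertonDyer.BirchSwinnertonDyer.Theorems.UniversalToricDescentKummerStrictMultiplicative
import Literature.NumberTheory.EllipticCurves.TateCurve.NumberFieldUniformizationTwistedKernelOfReductionIff
import Literature.NumberTheory.EllipticCurves.Greenberg1999.KummerImageMultiplicativeTateProofs
import Summits.BirchSwinnertonDyer.BirchSwinnertonDyer.Theorems.UniversalToricDescentTwinTateLineAtThree
import HarnessLib

/-!
# Greenberg LNM 1716 §2 p. 76 for the kernel-of-reduction datum, BOTH inclusions: at a multiplicative `v ∣ p`,
# `p` odd, `Im κ = Im λ` for `C_v = E[p^∞] ∩ E₁(K̄_v)` — `localKerOver = strictKer` (helper, theorems only; no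
# definition, no named fact, no `sorry`)

LEAD `bsd-wall-utd-p1` (g26), crux r205 stmt-BirchSwinnertonDyer-24737 `UniversalToricDescent.TwinAlgMuZeroAtThree`, line
`beta-road` v10, K2 stub `stub_howardOutputsOfFamily` (readout/LINK and D1-twin controls at `v ∣ 3`).  The tree carries two
Greenberg data at a multiplicative place: the TATE datum `Ψ(μ)` of the b2b cell (`X2.GreenbergVatsalTateDatum`; Greenberg's
fact `imKummer_ge_strictCondition_multiplicative` PROVED for it, `KummerImageMultiplicativeTateProofs`) and the
KERNEL-OF-REDUCTION datum `E[p^∞] ∩ E₁(K̄_v)` of the x9 cell (`WeierstrassCurve.kernelOfReductionLocalDatum`, the currency of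
Howard's ordinary filtration `torsionFilAt`/`ordinaryFiltrationAt` and of every readout file).  This file IDENTIFIES them
through `TateCurve.exists_twistedTateUniformisation_localKernelOfReduction_iff` (ATAEC §V.4 `E₁ = Ψ(1 + 𝔪)`, p763xxx):
a `p`-power torsion point lies in `E₁(K̄_v)` iff it is `Ψ(ζ)` for a root of unity `ζ` — so b2b's theorem applies VERBATIM to
the kernel-of-reduction datum, giving the inclusion `strictKer ≤ localKerOver` (`Im λ ⊆ Im κ`); with p763326
(`localKerOver ≤ strictKer`) this is Greenberg's EQUALITY for `C_v = E[p^∞] ∩ E₁(K̄_v)` at every multiplicative `v ∣ p`,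
`p` odd — the multiplicative counterpart, as a THEOREM, of x9's cite-only leading binder
`Greenberg1999.imKummer_eq_strictCondition_goodOrdinary_numberField` (good ordinary `v`).

* `exists_tateData_kernelOfReductionLocalDatum` — Tate data `(q, t, Ψ)` with the binder `hN` of Greenberg's multiplicative fact
  for `N := kernelOfReductionLocalDatum p v`;
* `strictKer_kernelOfReduction_le_localKerOver_of_hasMultiplicativeReductionAt` — `Im λ ⊆ Im κ`;
* **`localKerOver_eq_strictKer_kernelOfReduction_of_hasMultiplicativeReductionAt`** — `Im κ = Im λ`;
* `twin_localKerOver_eq_strictKer` — the twin frame at `p = 3` (`Rank1Residual.Mult W′ 3`, every `w ∣ 3`, every `H`).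

BSD is proved for no curve by any of this; 24737 stays OPEN.
-/

set_option autoImplicit false
-- the summit and its single problem are both named `BirchSwinnertonDyer` (registry layout D-0017)
set_option linter.dupNamespace false

noncomputable section

open scoped Classical NNReal

namespace Summit.BirchSwinnertonDyer.BirchSwinnertonDyer.Theorems.UniversalToricDescentKummerStrictEqMultiplicative

open NumberField IsDedekindDomain Field WeierstrassCurve
open Literature.NumberTheory.EllipticCurves Literature.NumberTheory.EllipticCurves.GreenbergSelmer
  Literature.NumberTheory.GaloisRepresentations IsDedekindDomain.HeightOneSpectrum
  Literature.NumberTheory.EllipticCurves.TateCurve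
  Summit.BirchSwinnertonDyer.BirchSwinnertonDyer.Theorems.UniversalToricDescentKummerStrictMultiplicative
  Summit.BirchSwinnertonDyer.BirchSwinnertonDyer.Theorems.UniversalToricDescentTwinTateLineAtThree

variable {K : Type} [Field K] [NumberField K] (W : WeierstrassCurve K) [W.IsElliptic]
  (p : ℕ) [hp : Fact p.Prime] {v : HeightOneSpectrum (𝓞 K)}

/-- **Tate data for the kernel-of-reduction datum.** At a multiplicative place `v ∣ p` there are `q`, `t = √γ(W)` and the
twisted Tate parametrisation `Ψ` (Silverman ATAEC V.5.2 (c)/V.5.3: surjective, kernel `q^ℤ`, `σ • Ψ(u) = χ(σ) Ψ(σu)`) such that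
**a `p`-power torsion point lies in `C_v = E[p^∞] ∩ E₁(K̄_v)` iff it is `Ψ(ζ)` for a root of unity `ζ`** — the binder `hN`
of `Greenberg1999.imKummer_ge_strictCondition_multiplicative` for `N := W.kernelOfReductionLocalDatum p v`
(`E₁ = Ψ(1 + 𝔪)`, ATAEC §V.4; a root of unity hitting `E[p^∞]` is a `p`-power root of unity, a principal unit at residue
characteristic `p`, and a principal unit hitting `E[p^∞]` is a root of unity since `ker Ψ = q^ℤ`).
[cite: SilvermanATAEC1994, Lemma V.5.2 (c), Thm. V.5.3, §V.4] [cite: GreenbergLNM1716, §2 pp. 73, 76] -/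
theorem exists_tateData_kernelOfReductionLocalDatum (hpv : ((p : ℕ) : 𝓞 K) ∈ v.asIdeal)
    (hmult : W.HasMultiplicativeReductionAt v) :
    ∃ (q : v.adicCompletion K) (t : AlgebraicClosure (v.adicCompletion K))
      (Ψ : Additive (AlgebraicClosure (v.adicCompletion K))ˣ →+ localPoints W (v.adicCompletion K)),
      q ≠ 0 ∧ Valued.v q < 1 ∧
      t ^ 2 = algebraMap (v.adicCompletion K) (AlgebraicClosure (v.adicCompletion K))
        (algebraMap K (v.adicCompletion K) (-(W.c₄ / W.c₆))) ∧
      Function.Surjective Ψ ∧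
      (∀ u : (AlgebraicClosure (v.adicCompletion K))ˣ, Ψ (Additive.ofMul u) = 0 ↔
        ∃ n : ℤ, (u : AlgebraicClosure (v.adicCompletion K)) =
          algebraMap (v.adicCompletion K) (AlgebraicClosure (v.adicCompletion K)) q ^ n) ∧
      (∀ (σ : absoluteGaloisGroup (v.adicCompletion K))
          (u : (AlgebraicClosure (v.adicCompletion K))ˣ),
        σ • Ψ (Additive.ofMul u) =
          (if Field.absoluteGaloisGroup.toAlgEquiv (v.adicCompletion K) σ t = t then (1 : ℤ)
            else -1) •
          Ψ (Additive.ofMul (Units.map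
            (Field.absoluteGaloisGroup.toAlgEquiv (v.adicCompletion K) σ :
              AlgebraicClosure (v.adicCompletion K) →* AlgebraicClosure (v.adicCompletion K))
            u))) ∧
      (∀ m : W.geomPrimaryTorsion p, m ∈ (W.kernelOfReductionLocalDatum p v).plus ↔
        ∃ ζ : (AlgebraicClosure (v.adicCompletion K))ˣ, IsOfFinOrder ζ ∧
          Ψ (Additive.ofMul ζ) = pointsMap W (v.adicCompletion K) (m : W.geomPoints)) := by
  set L := AlgebraicClosure (v.adicCompletion K) with hL
  obtain ⟨q, t, Ψ, hq0, hq1, -, ht, hsurj, hker, hΨσ, hiff⟩ :=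
    exists_twistedTateUniformisation_localKernelOfReduction_iff W v hmult
  have hw := coe_spectralValuation v
  have hred : ∀ u : Lˣ, v.spectralValuation ((u : L) - 1) < 1 →
      Ψ (Additive.ofMul u) ∈ W.localKernelOfReduction v :=
    fun u hu ↦ (hiff _).mpr ⟨u, hu, rfl⟩
  refine ⟨q, t, Ψ, hq0, hq1, ht, hsurj, hker, hΨσ, fun m ↦ ?_⟩
  rw [WeierstrassCurve.mem_kernelOfReductionLocalDatum_plus_iff]
  obtain ⟨k, hk⟩ := (AddCommGroup.mem_primaryComponent).1 m.2
  constructor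
  · -- `ι m ∈ E₁ = Ψ(1 + 𝔪)`: `ι m = Ψ(u)`, `u` a principal unit with `u^{p^k} ∈ q^ℤ`, hence `u^{p^k} = 1`
    intro hm
    obtain ⟨u, hu1, hu⟩ := (hiff _).mp hm
    refine ⟨u, ?_, hu⟩
    have hunorm : v.spectralValuation (u : L) = 1 := by
      have h := Valuation.map_add_eq_of_lt_left v.spectralValuation
        (x := (1 : L)) (y := (u : L) - 1) (by rw [map_one]; exact hu1)
      rwa [map_one, add_sub_cancel] at h
    have h0 : Ψ (Additive.ofMul (u ^ p ^ k)) = 0 := by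
      rw [ofMul_pow, map_nsmul, hu, ← map_nsmul, hk, map_zero]
    obtain ⟨a, ha⟩ := (hker _).1 h0
    have hq' : algebraMap (v.adicCompletion K) L q ≠ 0 :=
      (map_ne_zero_iff _ (algebraMap (v.adicCompletion K) L).injective).2 hq0
    have hwq0 : 0 < v.spectralValuation (algebraMap (v.adicCompletion K) L q) :=
      zero_lt_iff.2 ((map_ne_zero _).2 hq')
    have hwq : v.spectralValuation (algebraMap (v.adicCompletion K) L q) < 1 := by
      rw [← NNReal.coe_lt_coe, coe_spectralValuation_algebraMap hw, NNReal.coe_one]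
      exact Valued.toNormedField.norm_lt_one_iff.mpr hq1
    have hpow : v.spectralValuation (algebraMap (v.adicCompletion K) L q) ^ a =
        v.spectralValuation (algebraMap (v.adicCompletion K) L q) ^ (0 : ℤ) := by
      rw [zpow_zero, ← map_zpow₀, ← ha, Units.val_pow_eq_pow_val, map_pow, hunorm, one_pow]
    have ha0 : a = 0 := (zpow_right_strictAnti₀ hwq0 hwq).injective hpow
    rw [ha0, zpow_zero] at ha
    exact isOfFinOrder_iff_pow_eq_one.2 ⟨p ^ k, pow_pos hp.out.pos k, Units.ext ha⟩
  · -- a root of unity hitting `E[p^∞]` is a `p`-power root of unity, hence a principal unit, sent into `E₁`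
    rintro ⟨ζ, hζ, hζm⟩
    obtain ⟨n, hn, hζn⟩ := hζ.exists_pow_eq_one
    have hwζ : v.spectralValuation (ζ : L) = 1 := by
      have h1 : v.spectralValuation (ζ : L) ^ n = 1 := by
        rw [← map_pow, ← Units.val_pow_eq_pow_val, hζn, Units.val_one, map_one]
      exact (pow_eq_one_iff_of_nonneg zero_le hn.ne').mp h1
    have h0 : Ψ (Additive.ofMul (ζ ^ p ^ k)) = 0 := by
      rw [ofMul_pow, map_nsmul, hζm, ← map_nsmul, hk, map_zero]
    rw [← hζm]
    exact mem_localKernelOfReduction_of_unit_of_pow W p hpv hq0 hq1 Ψ hker hred ζ k hwζ h0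

/-- **`Im λ ⊆ Im κ` for `C_v = E[p^∞] ∩ E₁(K̄_v)` at a multiplicative `v ∣ p`, `p` odd**: for every `H ≤ Γ_K`,
`(kernelOfReductionLocalDatum p v).strictKer H ≤ localKerOver p H K_v` — b2b's PROVED Greenberg fact
`Greenberg1999.imKummer_ge_strictCondition_multiplicative_holds` applied with the Tate data of
`exists_tateData_kernelOfReductionLocalDatum`. [cite: GreenbergLNM1716, §2 pp. 75–76] -/
theorem strictKer_kernelOfReduction_le_localKerOver_of_hasMultiplicativeReductionAt (hp2 : p ≠ 2)
    (hpv : ((p : ℕ) : 𝓞 K) ∈ v.asIdeal) (hmult : W.HasMultiplicativeReductionAt v)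
    (H : Subgroup (absoluteGaloisGroup K)) :
    (W.kernelOfReductionLocalDatum p v).strictKer H ≤ W.localKerOver p H (v.adicCompletion K) := by
  obtain ⟨q, t, Ψ, hq0, hq1, ht, hsurj, hker, hΨσ, hN⟩ :=
    exists_tateData_kernelOfReductionLocalDatum W p hpv hmult
  exact Greenberg1999.imKummer_ge_strictCondition_multiplicative_holds W p hp2 v hpv hmult q t Ψ hq0 hq1 ht
    hsurj hker hΨσ (W.kernelOfReductionLocalDatum p v) hN H

/-- **Greenberg LNM 1716 §2 p. 76, `Im κ = Im λ` for `C_v = E[p^∞] ∩ E₁(K̄_v)`, PROVED**: at a multiplicative place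
`v ∣ p` (split or non-split), `p` odd, for every subgroup `H ≤ Γ_K`, the Kummer local condition and Greenberg's STRICT
condition for the kernel-of-reduction datum COINCIDE: `localKerOver p H K_v = (kernelOfReductionLocalDatum p v).strictKer H`
(`≤`: p763326; `≥`: the previous theorem). The multiplicative counterpart, as a theorem, of x9's cite-only
`Greenberg1999.imKummer_eq_strictCondition_goodOrdinary_numberField`. [cite: GreenbergLNM1716, §2 pp. 75–76]
[cite: SilvermanATAEC1994, Lemma V.5.2 (c), Thm. V.5.3, §V.4] -/
theorem localKerOver_eq_strictKer_kernelOfReduction_of_hasMultiplicativeReductionAt (hp2 : p ≠ 2)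
    (hpv : ((p : ℕ) : 𝓞 K) ∈ v.asIdeal) (hmult : W.HasMultiplicativeReductionAt v)
    (H : Subgroup (absoluteGaloisGroup K)) :
    W.localKerOver p H (v.adicCompletion K) = (W.kernelOfReductionLocalDatum p v).strictKer H :=
  le_antisymm (localKerOver_le_strictKer_kernelOfReduction_of_hasMultiplicativeReductionAt W p hp2 hpv hmult H)
    (strictKer_kernelOfReduction_le_localKerOver_of_hasMultiplicativeReductionAt W p hp2 hpv hmult H)

/-- **The twin frame at `p = 3`**: for `W′/ℚ` multiplicative at `3` (`Rank1Residual.Mult W′ 3`, bucket B of crux 24737), any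
number field `K`, any `w ∣ 3` and any `H ≤ Γ_K`: `localKerOver 3 H K_w = (kernelOfReductionLocalDatum 3 w).strictKer H` for
`E′_K = W′.baseChange K` (multiplicative at `w` by `hasMultiplicativeReductionAt_baseChange_of_mult_three`, p755134).
[cite: GreenbergLNM1716, §2 pp. 75–76] [cite: SilvermanAEC2009, VII.5 Prop. 5.4 (b)] -/
theorem twin_localKerOver_eq_strictKer (W' : WeierstrassCurve ℚ) [W'.IsElliptic] (hm : Rank1Residual.Mult W' 3)
    (K : Type) [Field K] [NumberField K] (w : HeightOneSpectrum (𝓞 K)) (hw : ((3 : ℕ) : 𝓞 K) ∈ w.asIdeal)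
    (H : Subgroup (absoluteGaloisGroup K)) :
    (W'.baseChange K).localKerOver 3 H (w.adicCompletion K) =
      ((W'.baseChange K).kernelOfReductionLocalDatum 3 w).strictKer H := by
  haveI : (W'.baseChange K).IsElliptic := by rw [WeierstrassCurve.baseChange]; infer_instance
  exact localKerOver_eq_strictKer_kernelOfReduction_of_hasMultiplicativeReductionAt (W'.baseChange K) 3 (by norm_num) hw
    (hasMultiplicativeReductionAt_baseChange_of_mult_three W' hm K w hw) H

end Summit.BirchSwinnertonDyer.BirchSwinnertonDyer.Theorems.UniversalToricDescentKummerStrictEqMultiplicative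

end
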